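import Summits.NavierStokesRegularity.FluidComputer.PalasekTowerStrainDoorAtRaw

/-!
# THE STRAIN DOOR AT ARBITRARY RATES `R`, IV: the PRICE of a raw strain certificate — the defect budget
# every certificate of the line `straindoor` must meet, at `R` and at `tuned`, in numbers

Cell `ns-blowup`, seat `ns-palasek-20303-p1` (LEAD prover on stmt-NavierStokesRegularity-20303 `EpisodeBaseT`;
route `PalasekTowerBreakdown`, rev 19; line `straindoor` at `tuned`). Sequel of `PalasekTowerStrainDoorAtRaw.lean`.
LABEL: E–C typing + kernel arithmetic (theorems only; no definition, no named fact, no `sorry`). WHAT THIS IS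
NOT: not Navier–Stokes evidence and NOT a refutation of the line — NECESSARY CONDITIONS that the fields of a
raw strain certificate `StrainDoor.RawCertificateData R …` impose on its own defect numbers; nothing is
inhabited or excluded.

## The price (numbers, not adjectives)

A raw strain certificate at the rates `R` carries a speed bound `B_w` of its reference, a short smoothing
window `h` with `(24 · 9.03 · (2B_w + 1))² h ≤ 1`, and the window inequality
`2 ((E₀ + G₂ w₀) e^{∫₀^{w₀} Γ} + 4 G₂ h) h^{-3/4} ≤ δ ≤ 1/2` (`w₀ = wfirstAt R`). Its speed readout
`Y₁(R) + η + δ ≤ ‖w(w₀, x)‖ ≤ B_w` forces `B_w > Y₁(R)`. Hence (this file):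

* `RawCertificateData.delta_nonneg`, `….Y_one_lt_Bw`, `….h_le` — `0 ≤ δ`, `Y₁(R) < B_w`,
  `h ≤ (24 · 9.03 · (2B_w + 1))⁻²`;
* `RawCertificateData.defect_budget` — `(E₀ + G₂ w₀) e^{∫Γ} ≤ (δ/2) h^{3/4}`;
* **`RawCertificateData.defect_budget_speedScale`** — `(E₀ + G₂ w₀) e^{∫Γ} · (24 · 9.03 · (2Y₁(R) + 1))^{3/2} ≤ 1/4`:
  the `L²` datum gap plus window × raw residual, inflated by the strain fee `e^{∫Γ}`, is at most
  `¼ (24 · 9.03 · (2Y₁ + 1))^{-3/2}` — the smoothing length `√h` sits a factor `≈ 9.03 · 48 · Re₁` below the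
  core length `1/N₁`, and the `L² → L^∞` conversion pays `h^{-3/4}`;
* `TowerRates.two_rpow_le_tuned_Y_one` — `2^{34} ≤ Y₁(tuned)` (`Y₁ = 2^{24·(33/32)·(7/5)} = 2^{34.65}`);
* **`RawCertificateData.defect_budget_tuned`** — at `R = tuned`: `10^{19} · (E₀ + G₂ w₀) e^{∫Γ} ≤ 1/4`, i.e.
  `E₀ + G₂ · w₀ ≤ 2.5 · 10^{-20} · e^{-∫₀^{w₀}Γ}` in the units `ν = 1` of the register (where the natural `L²`
  size of a level-`1` structure is `Y₁ N₀^{-3/2} ≈ 0.4`): the certificate's raw residual must be certified to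
  about twenty digits RELATIVE, times the strain fee — multi-precision interval numerics, and a design
  objective «minimise `∫₀^{w₀} Γ`» (window 0 at `tuned` = 169.85 level-0 strain times, K193).

References: S. Palasek, arXiv:2605.13827 §4 [cite: Palasek2026ElementaryModel, §4]; M. Dashti, J. C. Robinson,
SIAM J. Numer. Anal. 46 (2008), Thm. 5 [cite: DashtiRobinson2008, Thm. 5]; H. Koch, N. Nadirashvili, G. Seregin,
V. Šverák, Acta Math. 203 (2009) §3 (3.5) [cite: KochNadirashviliSereginSverak2009, §3 (3.5) and §4 p. 8 (arXiv:0709.3599v1)].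
-/

noncomputable section

namespace Summit.NavierStokesRegularity.FluidComputer.PalasekTowerClayBridge

open Set MeasureTheory Metric Function InnerProductSpace
open scoped ENNReal NNReal ContDiff RealInnerProductSpace
open Literature.Analysis Literature.Analysis.FluidPDE

/-! ## §1 The speed scale of the tuned rates at level `1` -/

/-- `Y₁(tuned) = 2^{24 · (33/32) · (7/5)} ≥ 2^{34}`. [folklore] -/
theorem TowerRates.two_rpow_le_tuned_Y_one : (2 : ℝ) ^ (34 : ℝ) ≤ TowerRates.tuned.Y 1 := by
  have hN : TowerRates.tuned.N 1 = (2 : ℝ) ^ ((24 : ℝ) * (33 / 32 : ℝ) ^ 1) := TowerRates.tuned_N_eq_two_rpow 1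
  have hβ : TowerRates.tuned.β = 12 / 5 := rfl
  simp only [TowerRates.Y]
  rw [hN, hβ, ← Real.rpow_mul (by norm_num)]
  exact Real.rpow_le_rpow_of_exponent_le (by norm_num) (by norm_num)

namespace StrainDoor

variable {R : TowerRates}
  {U : EuclideanSpace ℝ (Fin 3) → EuclideanSpace ℝ (Fin 3)} {ρ : ℝ}
  {w : ℝ → EuclideanSpace ℝ (Fin 3) → EuclideanSpace ℝ (Fin 3)} {ψ : ℝ → EuclideanSpace ℝ (Fin 3) → ℝ}
  {r : ℝ → EuclideanSpace ℝ (Fin 3) → EuclideanSpace ℝ (Fin 3)}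
  {Γ : ℝ → ℝ} {Bw G₂ D E₀ h δ η : ℝ}

/-! ## §2 The defect budget of a raw strain certificate at the rates `R` -/

/-- The tolerance of a raw certificate is nonnegative (the initial-layer inequality has a nonnegative left
side). [folklore] -/
theorem RawCertificateData.delta_nonneg (c : RawCertificateData R U ρ w ψ r Γ Bw G₂ D E₀ h δ η) : 0 ≤ δ := by
  have hD : 0 ≤ D := (norm_nonneg _).trans (c.datum_sup 0)
  have hh : 0 ≤ h ^ (1 / 4 : ℝ) := Real.rpow_nonneg c.h_pos.le _
  have hG := c.G₂_nonneg
  have h1 : 0 ≤ 2 * (D + 4 * h ^ (1 / 4 : ℝ) * G₂) *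
      Real.exp (36 * (9.03 : ℝ) ^ 2 * (Bw + 1 + Bw) ^ 2 * h) := by positivity
  exact h1.trans c.δ_layer

/-- **The speed readout forces the reference speed bound above the level-`1` scale**: `Y₁(R) < B_w`.
[cite: Palasek2026ElementaryModel, §4] -/
theorem RawCertificateData.Y_one_lt_Bw (c : RawCertificateData R U ρ w ψ r Γ Bw G₂ D E₀ h δ η) :
    R.Y 1 < Bw := by
  obtain ⟨x, -, hx⟩ := c.speed
  have hW : Host.wfirstAt R ∈ Icc 0 (Host.wfirstAt R) := ⟨(Host.wfirstAt_pos R).le, le_rfl⟩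
  have h1 := c.speed_bdd _ hW x
  have h2 := c.delta_nonneg
  have h3 := c.η_pos
  linarith

/-- The smoothing window is at most `(24 · 9.03 · (2B_w + 1))⁻²`. [cite: KochNadirashviliSereginSverak2009, §3 (3.5) and §4 p. 8 (arXiv:0709.3599v1)] -/
theorem RawCertificateData.h_le (c : RawCertificateData R U ρ w ψ r Γ Bw G₂ D E₀ h δ η) :
    h ≤ ((24 * (9.03 : ℝ) * (Bw + 1 + Bw)) ^ 2)⁻¹ := by
  have hM : 0 < (24 * (9.03 : ℝ) * (Bw + 1 + Bw)) ^ 2 := by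
    have := c.Bw_pos; positivity
  have hsh := c.h_short
  rw [inv_eq_one_div, le_div_iff₀ hM]
  calc h * (24 * (9.03 : ℝ) * (Bw + 1 + Bw)) ^ 2 = (24 * (9.03 : ℝ) * (Bw + 1 + Bw)) ^ 2 * h := mul_comm _ _
    _ ≤ 1 := hsh

/-- **THE DEFECT BUDGET**: `(E₀ + G₂ w₀) e^{∫₀^{w₀}Γ} ≤ (δ/2) h^{3/4}` (drop the nonnegative `4 G₂ h` from the
window inequality and multiply by `h^{3/4}`). [cite: DashtiRobinson2008, Thm. 5] -/
theorem RawCertificateData.defect_budget (c : RawCertificateData R U ρ w ψ r Γ Bw G₂ D E₀ h δ η) :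
    (E₀ + G₂ * Host.wfirstAt R) * Real.exp (∫ s in (0 : ℝ)..Host.wfirstAt R, Γ s) ≤
      δ / 2 * h ^ (3 / 4 : ℝ) := by
  set X : ℝ := (E₀ + G₂ * Host.wfirstAt R) * Real.exp (∫ s in (0 : ℝ)..Host.wfirstAt R, Γ s) with hX
  have hh34 : 0 < h ^ (3 / 4 : ℝ) := Real.rpow_pos_of_pos c.h_pos _
  have hhm34 : h ^ (-(3 / 4 : ℝ)) = (h ^ (3 / 4 : ℝ))⁻¹ := Real.rpow_neg c.h_pos.le _
  have hG4 : 0 ≤ 4 * G₂ * h := by have := c.G₂_nonneg; have := c.h_pos; positivity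
  have hwin := c.δ_window
  rw [hhm34, ← hX] at hwin
  -- `2 (X + 4G₂h) / h^{3/4} ≤ δ` ⇒ `X ≤ δ h^{3/4} / 2`
  have h1 : 2 * (X + 4 * G₂ * h) ≤ δ * h ^ (3 / 4 : ℝ) := by
    have := mul_le_mul_of_nonneg_right hwin hh34.le
    rwa [mul_assoc, inv_mul_cancel₀ hh34.ne', mul_one] at this
  nlinarith

/-- **THE DEFECT BUDGET AGAINST THE SPEED SCALE**: `(E₀ + G₂ w₀) e^{∫Γ} · (24 · 9.03 · (2Y₁(R) + 1))^{3/2} ≤ 1/4`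
(`δ ≤ 1/2`, `h^{3/4} ≤ (24 · 9.03 · (2B_w + 1))^{-3/2} ≤ (24 · 9.03 · (2Y₁ + 1))^{-3/2}`).
[cite: DashtiRobinson2008, Thm. 5] [cite: KochNadirashviliSereginSverak2009, §3 (3.5) and §4 p. 8 (arXiv:0709.3599v1)] -/
theorem RawCertificateData.defect_budget_speedScale (c : RawCertificateData R U ρ w ψ r Γ Bw G₂ D E₀ h δ η) :
    (E₀ + G₂ * Host.wfirstAt R) * Real.exp (∫ s in (0 : ℝ)..Host.wfirstAt R, Γ s) *
        (24 * (9.03 : ℝ) * (2 * R.Y 1 + 1)) ^ (3 / 2 : ℝ) ≤ 1 / 4 := by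
  set X : ℝ := (E₀ + G₂ * Host.wfirstAt R) * Real.exp (∫ s in (0 : ℝ)..Host.wfirstAt R, Γ s) with hX
  set M : ℝ := 24 * (9.03 : ℝ) * (Bw + 1 + Bw) with hM
  set M₁ : ℝ := 24 * (9.03 : ℝ) * (2 * R.Y 1 + 1) with hM₁
  have hY : 0 < R.Y 1 := Real.rpow_pos_of_pos (R.N_pos 1) _
  have hBw := c.Y_one_lt_Bw
  have hM₁pos : 0 < M₁ := by positivity
  have hM₁M : M₁ ≤ M := by rw [hM, hM₁]; nlinarith
  have hMpos : 0 < M := hM₁pos.trans_le hM₁M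
  have hX0 : 0 ≤ X := by
    have := c.E₀_nonneg; have := c.G₂_nonneg; have := (Host.wfirstAt_pos R).le
    positivity
  -- `X ≤ (δ/2) h^{3/4} ≤ (1/4) h^{3/4}`
  have h1 : X ≤ 1 / 4 * h ^ (3 / 4 : ℝ) := by
    have hb := c.defect_budget
    rw [← hX] at hb
    have hδ := c.δ_le
    have hh34 : 0 ≤ h ^ (3 / 4 : ℝ) := Real.rpow_nonneg c.h_pos.le _
    nlinarith
  -- `h^{3/4} ≤ (M²)⁻¹ ^ (3/4) = (M^{3/2})⁻¹ ≤ (M₁^{3/2})⁻¹`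
  have h2 : h ^ (3 / 4 : ℝ) ≤ (M ^ (3 / 2 : ℝ))⁻¹ := by
    have hle : h ≤ (M ^ 2)⁻¹ := by have := c.h_le; rwa [← hM] at this
    have hstep : h ^ (3 / 4 : ℝ) ≤ ((M ^ 2)⁻¹) ^ (3 / 4 : ℝ) :=
      Real.rpow_le_rpow c.h_pos.le hle (by norm_num)
    refine hstep.trans (le_of_eq ?_)
    rw [Real.inv_rpow (by positivity), show (M ^ 2 : ℝ) = M ^ (2 : ℝ) by norm_cast,
      ← Real.rpow_mul hMpos.le]
    norm_num
  have h3 : (M ^ (3 / 2 : ℝ))⁻¹ ≤ (M₁ ^ (3 / 2 : ℝ))⁻¹ := by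
    have hp : 0 < M₁ ^ (3 / 2 : ℝ) := Real.rpow_pos_of_pos hM₁pos _
    exact inv_anti₀ hp (Real.rpow_le_rpow hM₁pos.le hM₁M (by norm_num))
  have hM₁p : 0 < M₁ ^ (3 / 2 : ℝ) := Real.rpow_pos_of_pos hM₁pos _
  have h4 : X ≤ 1 / 4 * (M₁ ^ (3 / 2 : ℝ))⁻¹ := h1.trans (by nlinarith [h2.trans h3])
  calc X * M₁ ^ (3 / 2 : ℝ) ≤ 1 / 4 * (M₁ ^ (3 / 2 : ℝ))⁻¹ * M₁ ^ (3 / 2 : ℝ) :=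
        mul_le_mul_of_nonneg_right h4 hM₁p.le
    _ = 1 / 4 := by rw [mul_assoc, inv_mul_cancel₀ hM₁p.ne', mul_one]

/-! ## §3 At the tuned rates: twenty digits times the strain fee -/

/-- `10^{19} ≤ (24 · 9.03 · (2 · 2^{34} + 1))^{3/2}` (`x^{3/2} = x √x` with `x ≥ 7.4 · 10^{12}`,
`√x ≥ 2.7 · 10^6`). [folklore] -/
theorem ten_pow_le_speedScale_tuned :
    (10 : ℝ) ^ (19 : ℕ) ≤ (24 * (9.03 : ℝ) * (2 * (2 : ℝ) ^ (34 : ℝ) + 1)) ^ (3 / 2 : ℝ) := by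
  set x : ℝ := 24 * (9.03 : ℝ) * (2 * (2 : ℝ) ^ (34 : ℝ) + 1) with hx
  have h234 : (2 : ℝ) ^ (34 : ℝ) = 2 ^ (34 : ℕ) := by norm_cast
  have hx_ge : (7.4e12 : ℝ) ≤ x := by rw [hx, h234]; norm_num
  have hxpos : 0 < x := lt_of_lt_of_le (by norm_num) hx_ge
  have hsqrt : (2.7e6 : ℝ) ≤ Real.sqrt x := by
    rw [Real.le_sqrt (by norm_num) hxpos.le]; nlinarith
  have hsplit : x ^ (3 / 2 : ℝ) = x * Real.sqrt x := by
    rw [show (3 / 2 : ℝ) = 1 + 1 / 2 by norm_num, Real.rpow_add hxpos, Real.rpow_one, Real.sqrt_eq_rpow]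
  rw [hsplit]
  calc (10 : ℝ) ^ (19 : ℕ) ≤ 7.4e12 * 2.7e6 := by norm_num
    _ ≤ x * Real.sqrt x := mul_le_mul hx_ge hsqrt (by norm_num) hxpos.le

/-- **THE PRICE AT `tuned`**: every raw strain certificate of the line `straindoor` at the tuned rates satisfies
`10^{19} · (E₀ + G₂ · w₀) · e^{∫₀^{w₀} Γ} ≤ 1/4` — the `L²` datum gap plus window × raw residual is at most
`2.5 · 10^{-20} · e^{-∫Γ}` in the units `ν = 1` of the register. [cite: DashtiRobinson2008, Thm. 5]
[cite: Palasek2026ElementaryModel, §4] -/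
theorem RawCertificateData.defect_budget_tuned
    (c : RawCertificateData TowerRates.tuned U ρ w ψ r Γ Bw G₂ D E₀ h δ η) :
    (10 : ℝ) ^ (19 : ℕ) * ((E₀ + G₂ * Host.wfirstAt TowerRates.tuned) *
        Real.exp (∫ s in (0 : ℝ)..Host.wfirstAt TowerRates.tuned, Γ s)) ≤ 1 / 4 := by
  set X : ℝ := (E₀ + G₂ * Host.wfirstAt TowerRates.tuned) *
    Real.exp (∫ s in (0 : ℝ)..Host.wfirstAt TowerRates.tuned, Γ s) with hX
  have hX0 : 0 ≤ X := by
    have := c.E₀_nonneg; have := c.G₂_nonneg; have := (Host.wfirstAt_pos TowerRates.tuned).le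
    positivity
  have hmain := c.defect_budget_speedScale
  rw [← hX] at hmain
  -- monotonicity of the speed scale in `Y₁`: `2^{34} ≤ Y₁(tuned)`
  have hY := TowerRates.two_rpow_le_tuned_Y_one
  have hmono : (24 * (9.03 : ℝ) * (2 * (2 : ℝ) ^ (34 : ℝ) + 1)) ^ (3 / 2 : ℝ) ≤
      (24 * (9.03 : ℝ) * (2 * TowerRates.tuned.Y 1 + 1)) ^ (3 / 2 : ℝ) :=
    Real.rpow_le_rpow (by positivity) (by nlinarith) (by norm_num)
  calc (10 : ℝ) ^ (19 : ℕ) * X ≤ (24 * (9.03 : ℝ) * (2 * TowerRates.tuned.Y 1 + 1)) ^ (3 / 2 : ℝ) * X :=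
        mul_le_mul_of_nonneg_right (ten_pow_le_speedScale_tuned.trans hmono) hX0
    _ = X * (24 * (9.03 : ℝ) * (2 * TowerRates.tuned.Y 1 + 1)) ^ (3 / 2 : ℝ) := mul_comm _ _
    _ ≤ 1 / 4 := hmain

end StrainDoor

end Summit.NavierStokesRegularity.FluidComputer.PalasekTowerClayBridge

end
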